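import Summits.CriticalPhenomena.CardyFormulaZ2.Theorems.CardyComplexConeEdgePrecompactUFRSMarkedDecayRectFactors

/-!
# UFRS, decay at the marked points (rectangles), part 5: the per-box bound of the MARKED branch
(line `qkz-strip-boundary-arm` of crux `CardyComplexCone.EdgePrecompact`, stmt-CriticalPhenomena-11387;
support for the registered sub-goal `ufrs_markedPointDecay_rect`, wave 3 of lead c4)

`markedTerm_le_W3M` (registered): for a box centre `q ∈ D` within `2η` of `∂D`, a marked edge `e₀`
(midpoint `m`), a class `U ≥ η` and scales `d, R' > 0`, the guarded event
`G = [dist q m ≤ 2U + 3η, U ≤ 4R', 16d ≤ R', marked edges ≥ U - 3η from q] ∩ F₁ ∩ F₂ ∩ J₁ ∩ J₂ ∩ J₃`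
has `P(G) ≤ K (η/U)^{1+α} (U/ρ)^β`, `K = C_T'² 512^{1+α} C_J'³ 262144^β`. The five events read
the pairwise disjoint edge annuli `[7η, min(d/2,U/4) - 3η]`, `[2d + 3η, U/4 - 3η]` around `q` and
`[6U, d/2 - 2U]`, `[max(2d,4U) + 2U, R' - 2U]`, `[8R' + 2U, ρ/4 - 2U]` around `m` (thickened by
`2δ ≤ η/2`; locality `determinedBy_ufrsStrands_W3M`), so `P(G)` factorises (`real_inter5_W3M`) and
the factor bounds of part 4 telescope.

References: G. F. Lawler, O. Schramm, W. Werner, Electron. J. Probab. 7 (2002), Appendix A;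
P. Nolin, Electron. J. Probab. 13 (2008), §4 (arm events in consecutive annuli).
-/

namespace Summit.CriticalPhenomena.CardyFormulaZ2.Cruxes.EdgePrecompact.QkzStripBoundaryArm

open MeasureTheory Filter Set Metric
open scoped Topology BigOperators Pointwise
open Literature.Probability.LatticeModels Literature.Probability.Percolation
open Literature.Probability.RandomPlanarGeometry (DobrushinDomain)
open Summit.CriticalPhenomena.CardyFormulaZ2.Theses.CardyComplexCone

noncomputable section

/-! ## Part 6: the per-box bound of the MARKED branch -/

/-- **The per-box bound of the MARKED branch.** For a box centre `q ∈ D` within `2η` of `∂D`, a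
marked edge `e₀` (midpoint `m`), a dyadic class `U ≥ η` of the distance to the nearest marked
edge and certificate scales `d`, `R'`, the guarded five-fold event
`G = [guard] ∩ F₁ ∩ F₂ ∩ J₁ ∩ J₂ ∩ J₃` — guard: `dist q m ≤ 2U + 3η`, `U ≤ 4R'`, `16 d ≤ R'`, and the marked
edges at distance `≥ U - 3η` from `q` once `64η ≤ U`; flat events `F₁`, `F₂` (three strands around
`q` at scales `[7η, min(d/2,U/4) - 3η]`, `[2d + 3η, U/4 - 3η]`); junction events `J₁`, `J₂`, `J₃`
(two strands around `m` at scales `[6U, d/2 - 2U]`, `[max(2d,4U) + 2U, R' - 2U]`,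
`[8R' + 2U, ρ/4 - 2U]`) — has probability at most `K (η/U)^{1+α} (U/ρ)^β`,
`K = C_T'² 512^{1+α} C_J'³ 262144^β`: the five events read pairwise disjoint edge annuli
(independence, `real_inter5_W3M`), and the five factor bounds telescope. Hypotheses `hT`, `hJ`:
the flat three-strand decay and the junction two-strand decay for the datum `E`, shift `w`. -/
theorem markedTerm_le_W3M : ∀ {D : DobrushinDomain} {E : DiscreteDobrushin} {w : Site 2} {η ρ U d R' CT α CJ β : ℝ} {q : ℂ} {e₀ : Sym2 (Site 2)}, E.IsZdAdmissible → E.δ ≤ η / 4 → (∀ (z : ℂ) (s S : ℝ), z ∈ D.carrier → infDist z D.carrierᶜ ≤ s → η ≤ s → 0 < S → (∀ e' : Sym2 (Site 2), (e' ∈ E.zdABEdges ∨ e' ∈ (shiftData E w).zdABEdges) → 2 * S ≤ dist (medialPoint E.δ e') z) → (bondPercolation (zdGraph 2) half).real (ufrsStrands E w z 3 s S) ≤ CT * (s / S) ^ (1 + α)) → (∀ e' : Sym2 (Site 2), (e' ∈ E.zdABEdges ∨ e' ∈ (shiftData E w).zdABEdges) → ∀ s S : ℝ, η ≤ s → 0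 < S → (bondPercolation (zdGraph 2) half).real (ufrsStrands E w (medialPoint E.δ e') 2 s S) ≤ CJ * (s / S) ^ β) → q ∈ D.carrier → infDist q D.carrierᶜ ≤ 2 * η → (e₀ ∈ E.zdABEdges ∨ e₀ ∈ (shiftData E w).zdABEdges) → 0 < η → η ≤ U → 0 < d → 0 < R' → 0 < ρ → 0 < α → 0 < β → (bondPercolation (zdGraph 2) half).real {ω : BondConfig (Site 2) | (dist q (medialPoint E.δ e₀) ≤ 2 * U + 3 * η ∧ U ≤ 4 * R' ∧ 16 * d ≤ R' ∧ (64 * η ≤ U → ∀ e' : Sym2 (Site 2), (e' ∈ E.zdABEdges ∨ e' ∈ (shiftData E w).zdABEdges) → U - 3 * η ≤ dist (medialPoint E.δ e') q)) ∧ ((64 * η ≤ U ∧ 32 * η ≤ d) → ω ∈ ufrsStrands E w q 3 (7 * η) (min (d / 2) (U / 4) - 3 * η)) ∧ ((64 * η ≤ U ∧ d ≤ U / 16) → ω ∈ ufrsStrands E w q 3 (2 * d + 3 * η) (U / 4 - 3 * η)) ∧ (64 * U ≤ d → ω ∈ ufrsStrands E w (medialPoint E.δ e₀) 2 (6 * U)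 (d / 2 - 2 * U)) ∧ (64 * U ≤ R' → ω ∈ ufrsStrands E w (medialPoint E.δ e₀) 2 (max (2 * d) (4 * U) + 2 * U) (R' - 2 * U)) ∧ (64 * U ≤ ρ → ω ∈ ufrsStrands E w (medialPoint E.δ e₀) 2 (8 * R' + 2 * U) (ρ / 4 - 2 * U))} ≤ (max CT 1) ^ 2 * (512 : ℝ) ^ (1 + α) * ((max CJ 1) ^ 3 * (262144 : ℝ) ^ β) * ((η / U) ^ (1 + α) * (U / ρ) ^ β) := by
  intro D E w η ρ U d R' CT α CJ β q e₀ hE hδη hT hJ hq hqd he₀ hη hU hd hR' hρ hα hβ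
  set μ := bondPercolation (zdGraph 2) half with hμ
  set m := medialPoint E.δ e₀ with hm
  have hδ : 0 < E.δ := hE.delta_pos
  have hUpos : 0 < U := by linarith
  have hD₂ : 0 < min (max d (32 * η)) (U / 16) := lt_min (lt_max_of_lt_right (by linarith)) (by linarith)
  have hD₁ : 0 < max d (64 * U) := lt_max_of_lt_right (by linarith)
  have hR₁ : 0 < max R' (64 * U) := lt_max_of_lt_right (by linarith)
  have hρ₁ : 0 < max ρ (64 * U) := lt_max_of_lt_right (by linarith)
  have hKnonneg : 0 ≤ (max CT 1) ^ 2 * (512 : ℝ) ^ (1 + α) * ((max CJ 1) ^ 3 * (262144 : ℝ) ^ β) *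
      ((η / U) ^ (1 + α) * (U / ρ) ^ β) := by positivity
  by_cases hg : dist q m ≤ 2 * U + 3 * η ∧ U ≤ 4 * R' ∧ 16 * d ≤ R' ∧ (64 * η ≤ U → ∀ e' : Sym2 (Site 2),
      (e' ∈ E.zdABEdges ∨ e' ∈ (shiftData E w).zdABEdges) → U - 3 * η ≤ dist (medialPoint E.δ e') q)
  swap
  · -- empty event
    refine le_trans (measureReal_mono (s₂ := (∅ : Set (BondConfig (Site 2))))
      (fun ω hω => (hg (Set.mem_setOf_eq ▸ hω).1).elim) (by simp)) ?_
    rw [measureReal_empty]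
    exact hKnonneg
  obtain ⟨hqm, hU4, hdR', hsep⟩ := hg
  have hJm : ∀ s S : ℝ, η ≤ s → 0 < S → μ.real (ufrsStrands E w m 2 s S) ≤ CJ * (s / S) ^ β := hJ e₀ he₀
  -- the event is the five-fold intersection of the guarded events
  have hGeq : {ω : BondConfig (Site 2) |
      (dist q m ≤ 2 * U + 3 * η ∧ U ≤ 4 * R' ∧ 16 * d ≤ R' ∧ (64 * η ≤ U → ∀ e' : Sym2 (Site 2),
        (e' ∈ E.zdABEdges ∨ e' ∈ (shiftData E w).zdABEdges) → U - 3 * η ≤ dist (medialPoint E.δ e') q)) ∧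
      ((64 * η ≤ U ∧ 32 * η ≤ d) → ω ∈ ufrsStrands E w q 3 (7 * η) (min (d / 2) (U / 4) - 3 * η)) ∧
      ((64 * η ≤ U ∧ d ≤ U / 16) → ω ∈ ufrsStrands E w q 3 (2 * d + 3 * η) (U / 4 - 3 * η)) ∧
      (64 * U ≤ d → ω ∈ ufrsStrands E w m 2 (6 * U) (d / 2 - 2 * U)) ∧
      (64 * U ≤ R' → ω ∈ ufrsStrands E w m 2 (max (2 * d) (4 * U) + 2 * U) (R' - 2 * U)) ∧
      (64 * U ≤ ρ → ω ∈ ufrsStrands E w m 2 (8 * R' + 2 * U) (ρ / 4 - 2 * U))} =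
    {ω : BondConfig (Site 2) | (64 * η ≤ U ∧ 32 * η ≤ d) → ω ∈ ufrsStrands E w q 3 (7 * η) (min (d / 2) (U / 4) - 3 * η)} ∩
    {ω : BondConfig (Site 2) | (64 * η ≤ U ∧ d ≤ U / 16) → ω ∈ ufrsStrands E w q 3 (2 * d + 3 * η) (U / 4 - 3 * η)} ∩
    {ω : BondConfig (Site 2) | 64 * U ≤ d → ω ∈ ufrsStrands E w m 2 (6 * U) (d / 2 - 2 * U)} ∩
    {ω : BondConfig (Site 2) | 64 * U ≤ R' → ω ∈ ufrsStrands E w m 2 (max (2 * d) (4 * U) + 2 * U) (R' - 2 * U)} ∩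
    {ω : BondConfig (Site 2) | 64 * U ≤ ρ → ω ∈ ufrsStrands E w m 2 (8 * R' + 2 * U) (ρ / 4 - 2 * U)} := by
    ext ω
    simp only [Set.mem_setOf_eq, Set.mem_inter_iff]
    exact ⟨fun h => ⟨⟨⟨⟨h.2.1, h.2.2.1⟩, h.2.2.2.1⟩, h.2.2.2.2.1⟩, h.2.2.2.2.2⟩,
      fun h => ⟨⟨hqm, hU4, hdR', hsep⟩, h.1.1.1.1, h.1.1.1.2, h.1.1.2, h.1.2, h.2⟩⟩
  have hmin : min (d / 2) (U / 4) ≤ U / 4 := min_le_right _ _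
  have hmin' : min (d / 2) (U / 4) ≤ d / 2 := min_le_left _ _
  have hmax : 2 * d ≤ max (2 * d) (4 * U) := le_max_left _ _
  have hmax' : 4 * U ≤ max (2 * d) (4 * U) := le_max_right _ _
  rw [hGeq, real_inter5_W3M
    (determinedBy_imp_W3M (determinedBy_ufrsStrands_W3M E w q 3 _ _ hδ))
    (determinedBy_imp_W3M (determinedBy_ufrsStrands_W3M E w q 3 _ _ hδ))
    (determinedBy_imp_W3M (determinedBy_ufrsStrands_W3M E w m 2 _ _ hδ))
    (determinedBy_imp_W3M (determinedBy_ufrsStrands_W3M E w m 2 _ _ hδ))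
    (determinedBy_imp_W3M (determinedBy_ufrsStrands_W3M E w m 2 _ _ hδ))
    (measurableSet_imp_W3M (measurableSet_ufrsStrands_W3M E w q 3 _ _ hδ))
    (measurableSet_imp_W3M (measurableSet_ufrsStrands_W3M E w q 3 _ _ hδ))
    (measurableSet_imp_W3M (measurableSet_ufrsStrands_W3M E w m 2 _ _ hδ))
    (measurableSet_imp_W3M (measurableSet_ufrsStrands_W3M E w m 2 _ _ hδ))
    (measurableSet_imp_W3M (measurableSet_ufrsStrands_W3M E w m 2 _ _ hδ))
    (disjoint_annulusEdges_W3M _ (by rw [dist_self]; linarith))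
    (disjoint_annulusEdges_W3M _ (by linarith))
    (disjoint_annulusEdges_W3M _ (by linarith))
    (disjoint_annulusEdges_W3M _ (by linarith))
    (disjoint_annulusEdges_W3M _ (by linarith))
    (disjoint_annulusEdges_W3M _ (by linarith))
    (disjoint_annulusEdges_W3M _ (by linarith))
    (disjoint_annulusEdges_W3M _ (by rw [dist_self]; linarith))
    (disjoint_annulusEdges_W3M _ (by rw [dist_self]; linarith))
    (disjoint_annulusEdges_W3M _ (by rw [dist_self]; linarith))]
  -- the five factor bounds
  have b₁ := flat₁_le_W3M (d := d) hT hq hqd hη hU hα hsep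
  have b₂ := flat₂_le_W3M hT hq hqd hη hU hd hα hsep
  have b₃ := junc₁_le_W3M (d := d) hJm hη hU hβ
  have b₄ := junc₂_le_W3M (R' := R') hJm hη hU hd hβ
  have b₅ := junc₃_le_W3M (ρ := ρ) hJm hη hU hR' hβ
  -- telescoping
  have e₁ : (32 * η / min (max d (32 * η)) (U / 16)) ^ (1 + α) * (16 * min (max d (32 * η)) (U / 16) / U) ^ (1 + α) =
      (512 : ℝ) ^ (1 + α) * (η / U) ^ (1 + α) := by
    rw [← Real.mul_rpow (by positivity) (by positivity), ← Real.mul_rpow (by positivity) (by positivity)]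
    congr 1
    field_simp
    ring
  have e₂ : (64 * U / max d (64 * U)) ^ β * (64 * max d (64 * U) / max R' (64 * U)) ^ β *
      (64 * max R' (64 * U) / max ρ (64 * U)) ^ β = (262144 * (U / max ρ (64 * U))) ^ β := by
    rw [← Real.mul_rpow (by positivity) (by positivity), ← Real.mul_rpow (by positivity) (by positivity)]
    congr 1
    field_simp
    ring
  have e₃ : (262144 * (U / max ρ (64 * U))) ^ β ≤ (262144 : ℝ) ^ β * (U / ρ) ^ β := by
    rw [← Real.mul_rpow (by positivity) (by positivity)]
    refine Real.rpow_le_rpow (by positivity) ?_ hβ.le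
    exact mul_le_mul_of_nonneg_left (div_le_div_of_nonneg_left hUpos.le hρ (le_max_left _ _)) (by norm_num)
  calc μ.real {ω : BondConfig (Site 2) | (64 * η ≤ U ∧ 32 * η ≤ d) → ω ∈ ufrsStrands E w q 3 (7 * η) (min (d / 2) (U / 4) - 3 * η)} *
        μ.real {ω : BondConfig (Site 2) | (64 * η ≤ U ∧ d ≤ U / 16) → ω ∈ ufrsStrands E w q 3 (2 * d + 3 * η) (U / 4 - 3 * η)} *
        μ.real {ω : BondConfig (Site 2) | 64 * U ≤ d → ω ∈ ufrsStrands E w m 2 (6 * U) (d / 2 - 2 * U)} *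
        μ.real {ω : BondConfig (Site 2) | 64 * U ≤ R' → ω ∈ ufrsStrands E w m 2 (max (2 * d) (4 * U) + 2 * U) (R' - 2 * U)} *
        μ.real {ω : BondConfig (Site 2) | 64 * U ≤ ρ → ω ∈ ufrsStrands E w m 2 (8 * R' + 2 * U) (ρ / 4 - 2 * U)}
      ≤ (max CT 1 * (32 * η / min (max d (32 * η)) (U / 16)) ^ (1 + α)) *
        (max CT 1 * (16 * min (max d (32 * η)) (U / 16) / U) ^ (1 + α)) *
        (max CJ 1 * (64 * U / max d (64 * U)) ^ β) *
        (max CJ 1 * (64 * max d (64 * U) / max R' (64 * U)) ^ β) *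
        (max CJ 1 * (64 * max R' (64 * U) / max ρ (64 * U)) ^ β) := by
          gcongr
    _ = (max CT 1) ^ 2 * ((32 * η / min (max d (32 * η)) (U / 16)) ^ (1 + α) *
          (16 * min (max d (32 * η)) (U / 16) / U) ^ (1 + α)) *
        ((max CJ 1) ^ 3 * ((64 * U / max d (64 * U)) ^ β * (64 * max d (64 * U) / max R' (64 * U)) ^ β *
          (64 * max R' (64 * U) / max ρ (64 * U)) ^ β)) := by ring
    _ ≤ (max CT 1) ^ 2 * ((512 : ℝ) ^ (1 + α) * (η / U) ^ (1 + α)) *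
        ((max CJ 1) ^ 3 * ((262144 : ℝ) ^ β * (U / ρ) ^ β)) := by
          rw [e₁, e₂]
          gcongr
    _ = (max CT 1) ^ 2 * (512 : ℝ) ^ (1 + α) * ((max CJ 1) ^ 3 * (262144 : ℝ) ^ β) *
      ((η / U) ^ (1 + α) * (U / ρ) ^ β) := by ring

end

end Summit.CriticalPhenomena.CardyFormulaZ2.Cruxes.EdgePrecompact.QkzStripBoundaryArm
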